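/-
Origin: expansion seat `planner-pub-hodgecm-pv03-0`, handover v2 2026-08-18T03:34:00Z (`HOME/pub-hodgecm-pv03/lean/Pv03/PerL34/WedgeToClasses.lean`, md5 e1e434ea, 219 lines);
landed by the gen-5 packager in gate run 19 as `HodgeCM/PerL34/WedgeToClasses.lean` (import ^import Pv0[0-9]\.PerL34\.→import HodgeCM.PerL34. ×1).
-/
/-
pub-hodgecm cell — DAG-node prover pv03 (session planner-pub-hodgecm-pv03-0, unit pub-hodgecm-pv03).
Node N33 of HOME/LEMMAS.md, second half: the bridge from PerL v5 Proposition 4.3 ON ONE-FORMS (the abstract shell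
of `WedgeNonvanishing.lean` / pv01's `LineField.lean`) to the package's typing of the same proposition ON CLASSES —
the carver's `HodgeCM.PerL34.N33_wedge T := T.Open_thetaWedge` (Carver/PerL34/Wedge.lean), i.e. prl1's model fact A6
"THE HEART" (`HodgeCM/Automorphic/ThetaFacts.lean`).  This file is an HONEST SPLIT (package kind L2) of that fact:
`Open_thetaWedge ⇐ (per good context: a forms-dictionary whose spans are non-zero / continuous / Δ-stable [N33c],
satisfy the line-field alternative [N33e, kernel-checked by pv01 modulo its PRINT shell inputs], have all data
allowed [L4.2(b) = N31], and whose class map is the de Rham class map [DEFINITIONAL] obeying Hodge theory on the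
compact Kähler surface P_Γ [PRINT]) + LevelDirected [PROVED in the package]`.
Intended final place: `HodgeCM/PerL34/WedgeToClasses.lean`; imports `HodgeCM.PerL34.WedgeNonvanishing` (here
`Pv03.PerL34.WedgeNonvanishing` — rename the import on landing) and `HodgeCM.Automorphic.ThetaFacts`.
Nothing is asserted: every dictionary property is a named `Prop` consumed as an explicit hypothesis.
-/
import Summits.HodgeConjecture.HodgeCM.Automorphic.ThetaFacts
import Summits.HodgeConjecture.HodgeCM.PerL34.WedgeNonvanishing

set_option autoImplicit false

/-!
# N33 on classes: `Open_thetaWedge` (= carver's `N33_wedge`) from Proposition 4.3 on one-forms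

PerL v5 states Proposition 4.3 (tex ll. 639–642) for holomorphic one-forms `u_j` on the ball and their wedge
`u₁ ∧ u₂`; the package states it (A6 `Open_thetaWedge`, ll. 143–147 of `ThetaFacts.lean`) for degree-one CLASSES
`ω_j ∈ T.Theta V c j Γ ⊂ H¹(P_Γ, ℂ)` and their cup product.  The passage is the standard dictionary
(LEMMAS.md §3 D6): a `Γ_j`-invariant holomorphic one-form `u_j` descends to the compact (tex ll. 24, 71–73: "for
neat `K_f` these are smooth projective surfaces") Kähler surface `P_Γ` for every torsion-free `Γ ≤ Γ₁ ∩ Γ₂`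
(directedness of levels — PROVED in the package, `HodgeCM.levelDirected`), its de Rham class `[u_j]` lies in
`H^{1,0}(P_Γ)`, `[u₁] ∪ [u₂] = [u₁ ∧ u₂]` (de Rham), and a holomorphic `2`-form which is non-zero at one point has
non-zero class (Voisin, *Hodge Theory and Complex Algebraic Geometry I*, Prop. 7.5 / Cor. 7.6, §7.1.1: `H^{p,0}(X)`
is isomorphic to the space of holomorphic `p`-forms — a holomorphic form of class zero is `∂∂̄`-exact hence zero;
Cor. 6.15: the cup-product is bigraded).

## What is PROVED here (kernel-checked)

* `thetaWedge_ctx_of_forms` — for ONE context: forms-level Prop 4.3(i) (`∃` allowed data and `u_j ∈ gen_j d_j`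
  with `u₁(x) ∧ u₂(x) ≠ 0`) + the three dictionary Props + `LevelDirected` ⇒ `∃ Γ, ∃ ω₁ ∈ Theta 0 Γ, ∃ ω₂ ∈
  Theta 1 Γ, ω₁ ∪ ω₂ ≠ 0`.
* `thetaWedge_ctx_of_steps` — the same from the proof-STEPS N33c, N33e, L4.2(b) via
  `WedgeNonvanishing.N33_of_steps`-style composition (N33d is not needed for the wedge: it serves `S₁₂ ≠ 0`, which
  the package proves as `StubTree.prop43` from `lineField + gen12`).
* `open_thetaWedge_of_forms` / `open_thetaWedge_of_steps` — quantified over all good contexts: an honest split of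
  `T.Open_thetaWedge` (= `N33_wedge T`, by `Iff.rfl` in the carver's file).

## Labels (cell ABSOLUTE RULE) — which piece carries the difficulty

* `Dict_thetaClass₀/₁` — DEFINITIONAL for the intended dictionary (the model's `Theta c i Γ` IS the set of classes
  of the theta one-forms `u_f`, `f ∈ Θ_i(χ')[𝔭₊]`, of allowed data of type `Ψ_i` and level `⊇ Γ`: ThetaModel
  docstring "the THETA ONE-FORMS `Theta c i Γ ⊂ H¹(P_Γ, ℂ)` of type `Ψ_i` (the holomorphic one-forms `u_f` …)",
  PerL §3.2 ll. 258–268, Prop 4.3 pf ll. 643–657).  No difficulty; but see the HONESTY NOTE.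
* `Dict_cupWedge` — PRINT (Voisin I Prop. 7.5/Cor. 7.6 + de Rham cup = wedge) for the intended dictionary.
* the forms-level hypothesis — this is WHERE THE DIFFICULTY IS: N33c (non-vanishing of the `𝔭₊`-projections as
  one-forms = N33a + N33b, INTERNAL automorphic), N33e (line-field contradiction: kernel-checked by pv01 over this
  shell, modulo PRINT real approximation + isotropy representation), L4.2(b) = N31 (the R2–R4 first errors of the
  review history; INTERNAL over PRINT).
* HONESTY NOTE. The dictionary is quantified EXISTENTIALLY over `FormsModel` (data only, like `ThetaModel` itself):
  for an unintended `F` the `Dict_*` hypotheses are not definitional but carry content.  Faithfulness is therefore a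
  per-docstring matter for referee A, exactly as for `ThetaModel.Inputs`; the split does not claim more.
-/

noncomputable section

namespace HodgeCM
namespace PerL34
namespace WedgeToClasses

open HodgeCM.PerL34.WedgeNonvanishing

variable {L : CMField} {ι₁ : L →+* ℂ}

/-- **D6 dictionary, DATA** for one surface datum `(L, ι₁, V)` and one seesaw context `c` (types `Ψ₁ = c.Ψ 0`,
`Ψ₂ = c.Ψ 1`): the shell of Prop 4.3's proof (`G = U(2,1)` acting on `X = 𝔹²`, cotangent fibre `W = ℂ²`, the image
`Δ` of `G_U(L₀)`, the derivative cocycle `A`), the data types `D₁, D₂` (automorphic characters `χ'` of `[U(W_i)]`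
of type `e(Ψ_i)` for the FIXED `(W_i, μ_i)`), the spaces `gen_i d = {u_f : f ∈ Θ_i(χ')[𝔭₊]}` of theta one-forms,
the predicate "allowed" (Def 3.2), the LEVEL `lvl u` of a form (a torsion-free congruence subgroup under which it
is invariant, N33b: `u_f ∘ γ = u_f` for `γ ∈ Γ(f)`, tex l. 652; junk outside `⋃ gen_i d`), and the CLASS MAP
`cls Γ u = [u] ∈ H¹(P_Γ, ℂ)` of a form descending to `P_Γ` (junk if it does not descend).  Data only. -/
structure FormsModel (U : Universe) (V : HermSpace3 L ι₁) where
  /-- `U(2,1)` (real points of `U(V₃, h)` at `ι₁`) -/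
  G : Type
  /-- the ball `𝔹²` -/
  X : Type
  /-- the cotangent fibre `ℂ²` -/
  W : Type
  [instG : Group G]
  [instX : TopologicalSpace X]
  [instGX : MulAction G X]
  [instW₁ : NormedAddCommGroup W]
  [instW₂ : NormedSpace ℂ W]
  /-- the image of `G_U(L₀)` in `G` -/
  Δ : Subgroup G
  /-- the derivative cocycle through which `γ^*` acts on one-forms -/
  A : G → X → (W →L[ℂ] W)
  /-- characters `χ'₁` of `[U(W₁)]` of archimedean type `e(Ψ₁)` -/
  D₁ : Type
  /-- characters `χ'₂` of `[U(W₂)]` of archimedean type `e(Ψ₂)` -/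
  D₂ : Type
  /-- `{u_f : f ∈ Θ₁(χ'₁)[𝔭₊]}` -/
  gen₁ : D₁ → Submodule ℂ (X → W)
  /-- `{u_f : f ∈ Θ₂(χ'₂)[𝔭₊]}` -/
  gen₂ : D₂ → Submodule ℂ (X → W)
  /-- "`(W₁, μ₁, χ'₁)` is an allowed datum" (Def 3.2) -/
  allowed₁ : D₁ → Prop
  /-- "`(W₂, μ₂, χ'₂)` is an allowed datum" -/
  allowed₂ : D₂ → Prop
  /-- a torsion-free level of the form -/
  lvl : (X → W) → Level V
  /-- the de Rham class on `P_Γ` of a form descending to `Γ` -/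
  cls : (Γ : Level V) → (X → W) → U.CohC (U.pms L ι₁ V Γ) 1

attribute [instance] FormsModel.instG FormsModel.instX FormsModel.instGX FormsModel.instW₁ FormsModel.instW₂

variable {U : Universe} {V : HermSpace3 L ι₁}

namespace FormsModel

variable (F : FormsModel U V) (T : U.ThetaModel) (c : SeesawCtx L)

/-- **Prop 4.3(i) on forms** (tex ll. 640–641 "There are allowed data of types `Ψ₁,Ψ₂` and holomorphic
`1`-forms `u_j ∈ (π_j⊗τ)^{K_∞}` with `u₁ ∧ u₂ ≠ 0`") — literally the first conjunct of
`WedgeNonvanishing.N33_statement F.gen₁ F.gen₂ F.allowed₁ F.allowed₂ S₁₂`. -/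
def WedgeOnForms : Prop :=
  ∃ d₁ d₂, F.allowed₁ d₁ ∧ F.allowed₂ d₂ ∧
    ∃ u₁ ∈ F.gen₁ d₁, ∃ u₂ ∈ F.gen₂ d₂, ∃ x : F.X, LinearIndependent ℂ ![u₁ x, u₂ x]

/-- (Ported verbatim from the HodgeCMPerL package; no docstring in the source.) -/
theorem wedgeOnForms_iff {H : Type*} [AddCommGroup H] [Module ℂ H] (S₁₂ : Submodule ℂ H) :
    N33_statement F.gen₁ F.gen₂ F.allowed₁ F.allowed₂ S₁₂ ↔ F.WedgeOnForms ∧ S₁₂ ≠ ⊥ := Iff.rfl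

/-- **DEFINITIONAL (dictionary), type `Ψ₁`:** the class at any torsion-free level `Γ ≤ lvl u` of a theta one-form
`u ∈ gen₁ d` of an ALLOWED datum `d` is one of the model's theta classes of type `Ψ₁ = c.Ψ 0` at level `Γ`
(ThetaModel: "`Theta c i Γ` = the holomorphic one-forms `u_f` attached to the theta lifts `θ_φ(χ')` of the allowed
pairs `(W_i, μ_i, χ')`", PerL §3.2 ll. 258–268, Prop 4.3 pf ll. 643–657). -/
def Dict_thetaClass₀ : Prop :=
  ∀ d, F.allowed₁ d → ∀ u ∈ F.gen₁ d, ∀ Γ : Level V, Γ.Γ ≤ (F.lvl u).Γ → F.cls Γ u ∈ T.Theta V c 0 Γ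

/-- **DEFINITIONAL (dictionary), type `Ψ₂`:** as `Dict_thetaClass₀` for `gen₂`, `allowed₂` and `Theta c 1`. -/
def Dict_thetaClass₁ : Prop :=
  ∀ d, F.allowed₂ d → ∀ u ∈ F.gen₂ d, ∀ Γ : Level V, Γ.Γ ≤ (F.lvl u).Γ → F.cls Γ u ∈ T.Theta V c 1 Γ

/-- **PRINT (Hodge theory on the compact Kähler surface `P_Γ`) for the dictionary:** if the theta one-forms
`u₁ ∈ gen₁ d₁`, `u₂ ∈ gen₂ d₂` both descend to the torsion-free level `Γ` and `u₁(x) ∧ u₂(x) ≠ 0` at some point of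
the ball, then `[u₁] ∪ [u₂] ≠ 0` in `H²(P_Γ, ℂ)`: `[u₁] ∪ [u₂] = [u₁ ∧ u₂]` (de Rham) and `u₁ ∧ u₂` is a holomorphic
`2`-form, non-zero (at the image of `x`), whose class is therefore non-zero — Voisin, *Hodge Theory and Complex
Algebraic Geometry I* (CUP 2002), Prop. 7.5 and Cor. 7.6 (§7.1.1; `H^{p,0}(X)` ≅ holomorphic `p`-forms on a
compact Kähler `X`: an exact holomorphic form is `∂∂̄`-exact, hence zero by type), Cor. 6.15 (cup-product
bigraded); `P_Γ` compact smooth projective for neat `Γ`: PerL ll. 24, 71–73 (`G_U` anisotropic). -/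
def Dict_cupWedge : Prop :=
  ∀ d₁ d₂, ∀ u₁ ∈ F.gen₁ d₁, ∀ u₂ ∈ F.gen₂ d₂, ∀ Γ : Level V,
    Γ.Γ ≤ (F.lvl u₁).Γ → Γ.Γ ≤ (F.lvl u₂).Γ → (∃ x : F.X, LinearIndependent ℂ ![u₁ x, u₂ x]) →
      U.cup2C (U.pms L ι₁ V Γ) 1 (F.cls Γ u₁) (F.cls Γ u₂) ≠ 0

/-- **The forms-level INPUT of the split, from the proof-steps:** N33c (spans non-zero, continuous, `Δ`-stable),
N33e (the line-field alternative over the shell) and L4.2(b) (every datum allowed). -/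
def Steps : Prop :=
  N33c_statement F.Δ F.A F.gen₁ F.gen₂ ∧
    N33e_statement F.Δ F.A (⨆ d, F.gen₁ d) (⨆ d, F.gen₂ d) ∧ (∀ d, F.allowed₁ d) ∧ (∀ d, F.allowed₂ d)

/-- Prop 4.3(i) on forms from the steps (= `WedgeNonvanishing.N33_of_steps` without the `S₁₂`-clause). -/
theorem wedgeOnForms_of_steps (h : F.Steps) : F.WedgeOnForms := by
  obtain ⟨⟨⟨hne₁, hcont₁, hstab₁⟩, ⟨hne₂, hcont₂, hstab₂⟩⟩, he, ha₁, ha₂⟩ := h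
  obtain ⟨d₁, d₂, g₁, hg₁, g₂, hg₂, x, hli⟩ :=
    exists_mem_iSup_gen F.gen₁ F.gen₂ (he hne₁ hne₂ hcont₁ hcont₂ hstab₁ hstab₂)
  exact ⟨d₁, d₂, ha₁ d₁, ha₂ d₂, g₁, hg₁, g₂, hg₂, x, hli⟩

end FormsModel

/-- **Prop 4.3 on classes for ONE context, from Prop 4.3(i) on forms + the dictionary + directedness of levels.**
The common level is `Γ ≤ lvl u₁ ⊓ lvl u₂` from `LevelDirected` (PROVED in the package: `HodgeCM.levelDirected`). -/
theorem thetaWedge_ctx_of_forms {T : U.ThetaModel} {c : SeesawCtx L} (F : FormsModel U V) (hW : F.WedgeOnForms)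
    (h₀ : F.Dict_thetaClass₀ T c) (h₁ : F.Dict_thetaClass₁ T c) (hcup : F.Dict_cupWedge) (hLD : LevelDirected) :
    ∃ Γ : Level V, ∃ ω₁ ∈ T.Theta V c 0 Γ, ∃ ω₂ ∈ T.Theta V c 1 Γ,
      U.cup2C (U.pms L ι₁ V Γ) 1 ω₁ ω₂ ≠ 0 := by
  obtain ⟨d₁, d₂, ha₁, ha₂, u₁, hu₁, u₂, hu₂, hx⟩ := hW
  obtain ⟨Γ, hΓ₁, hΓ₂⟩ := hLD L ι₁ V (F.lvl u₁) (F.lvl u₂)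
  exact ⟨Γ, F.cls Γ u₁, h₀ d₁ ha₁ u₁ hu₁ Γ hΓ₁, F.cls Γ u₂, h₁ d₂ ha₂ u₂ hu₂ Γ hΓ₂,
    hcup d₁ d₂ u₁ hu₁ u₂ hu₂ Γ hΓ₁ hΓ₂ hx⟩

/-- The same from the proof-STEPS N33c, N33e, L4.2(b) (forms level) + dictionary + `LevelDirected`. -/
theorem thetaWedge_ctx_of_steps {T : U.ThetaModel} {c : SeesawCtx L} (F : FormsModel U V) (hS : F.Steps)
    (h₀ : F.Dict_thetaClass₀ T c) (h₁ : F.Dict_thetaClass₁ T c) (hcup : F.Dict_cupWedge) (hLD : LevelDirected) :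
    ∃ Γ : Level V, ∃ ω₁ ∈ T.Theta V c 0 Γ, ∃ ω₂ ∈ T.Theta V c 1 Γ,
      U.cup2C (U.pms L ι₁ V Γ) 1 ω₁ ω₂ ≠ 0 :=
  thetaWedge_ctx_of_forms F (F.wedgeOnForms_of_steps hS) h₀ h₁ hcup hLD

variable (T : U.ThetaModel)

/-- **Honest split of A6 `Open_thetaWedge` (= carver's `N33_wedge T`), forms version:** in every good context there
is a forms dictionary satisfying Prop 4.3(i) ON FORMS and the three dictionary properties. -/
def FormsInput : Prop :=
  ∀ {L : CMField} {ι₁ : L →+* ℂ} (V : HermSpace3 L ι₁) (c : SeesawCtx L), T.GoodCtx ι₁ c →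
    ∃ F : FormsModel U V, F.WedgeOnForms ∧ F.Dict_thetaClass₀ T c ∧ F.Dict_thetaClass₁ T c ∧ F.Dict_cupWedge

/-- **Honest split of A6, steps version:** in every good context there is a forms dictionary whose spans satisfy
N33c, N33e and L4.2(b), with the three dictionary properties.  THIS is the record in which pv01's kernel proof of
N33e (over the same shell) discharges a named piece of "the heart". -/
def StepsInput : Prop :=
  ∀ {L : CMField} {ι₁ : L →+* ℂ} (V : HermSpace3 L ι₁) (c : SeesawCtx L), T.GoodCtx ι₁ c →
    ∃ F : FormsModel U V, F.Steps ∧ F.Dict_thetaClass₀ T c ∧ F.Dict_thetaClass₁ T c ∧ F.Dict_cupWedge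

/-- (Ported verbatim from the HodgeCMPerL package; no docstring in the source.) -/
theorem open_thetaWedge_of_forms (hLD : LevelDirected) (h : FormsInput T) : T.Open_thetaWedge := by
  intro L ι₁ V c hc
  obtain ⟨F, hW, h₀, h₁, hcup⟩ := h V c hc
  exact thetaWedge_ctx_of_forms F hW h₀ h₁ hcup hLD

/-- (Ported verbatim from the HodgeCMPerL package; no docstring in the source.) -/
theorem open_thetaWedge_of_steps (hLD : LevelDirected) (h : StepsInput T) : T.Open_thetaWedge := by
  intro L ι₁ V c hc
  obtain ⟨F, hS, h₀, h₁, hcup⟩ := h V c hc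
  exact thetaWedge_ctx_of_steps F hS h₀ h₁ hcup hLD

/-- (Ported verbatim from the HodgeCMPerL package; no docstring in the source.) -/
theorem stepsInput_imp_formsInput (h : StepsInput T) : FormsInput T := by
  intro L ι₁ V c hc
  obtain ⟨F, hS, h₀, h₁, hcup⟩ := h V c hc
  exact ⟨F, F.wedgeOnForms_of_steps hS, h₀, h₁, hcup⟩

end WedgeToClasses
end PerL34
end HodgeCM

end
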